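import Literature.Geometry.Kaehler.ComplexTorusVerySimpleFixedPoints
import Mathlib.LinearAlgebra.FreeModule.Finite.CardQuotient
import Mathlib.LinearAlgebra.FreeModule.PID
import Mathlib.LinearAlgebra.Isomorphisms
import Mathlib.LinearAlgebra.Dimension.FreeAndStrongRankCondition
import HarnessLib

/-!
# The rank invariant `d` of `End_δ(A)`: `rk_ℤ End_δ(A) = d(ℓ - 1)`, `dim_{𝔽_ℓ} R = d ≤ r²` (Dolgachev–Zarhin 2024, proof of Theorem 2.18 and Remark 2.17, at torus level)

Layer `Literature/Geometry/Kaehler`, namespace `Literature.Geometry.Kaehler.ComplexTorus`; lane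
`lit-hodgefound` (Track 2 foundations library), row g13-#2 of seat p11 (gen 13). Sequel of
`ComplexTorusVerySimpleFixedPoints.lean` (g13-#1 FILE 2: Theorem 2.18 at torus level, proved there through
Nakayama's lemma) supplying the intermediate claims of the PRINTED proof that FILE 2 bypassed — the rank
`d` of `End_δ(A)` over `ℤ[δ]`, "`End_δ(A)/(1 - δ)End_δ(A)` is a `d`-dimensional `𝔽_ℓ`-algebra",
"`dim_{𝔽_ℓ}(R) = d`", "`d ≤ r²`", "`d = 1` or `d = r²`" — and the resulting UNCONDITIONAL
characterisations of the two alternatives of Theorem 2.18 by the rank of `End_δ(A)`. THEOREMS ONLY (no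
definition, no named fact; net debt 0).

## Source READ (held text), verbatim

I. Dolgachev, Yu. G. Zarhin, *Endomorphisms of Complex Abelian Varieties* (2024; bib `DolgachevZarhin2024`;
held text `paper:galaxy-pdf-8712177384607648460`), §2.2:

* p0035 (before Remark 2.17): "Let `End_δ(A)` be the centralizer of `δ` in `End(A)`. […] As above,
  `End_δ(A)` is a direct sum of `d` projective `ℤ[δ]`-modules of rank `1` for some positive integer
  `d`. […] `μ_r : End_δ(A) ↪ End_{ℤ[δ]}(Λ)` (2.17). *Remark* 2.17. Comparing the ranks in (2.17), we
  obtain the inequality `d ≤ r²`."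
* p0036 (proof of Theorem 2.18): "First, notice that `End_δ(A)` is a torsion free finitely generated
  `ℤ[δ]`-algebra, hence, is a projective `ℤ[δ]`-module of finite rank, say `d`. Hence, the quotient
  `End_δ(A)/(1-δ)End_δ(A)` is a `d`-dimensional `ℤ[δ]/(1-δ) = 𝔽_ℓ`-algebra. […] the action of
  `End_δ(A)` on `A^δ` induces the `𝔽_ℓ`-algebra embedding `End_δ(A)/(1-δ)End_δ(A) ↪ End_{𝔽_ℓ}(A^δ)`
  (2.19). […] the image `R` of the embedding (2.19) […]. Hence,
  `dim_{𝔽_ℓ}(R) = dim_{𝔽_ℓ}(End_δ(A)/(1-δ)End_δ(A)) = d.` Since the Galois module `A^δ` is very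
  simple, either `d = 1` or `d = dim_{𝔽_ℓ}(End_{𝔽_ℓ}(A^δ)) = (dim_{𝔽_ℓ}(A^δ))² = r²`."
* p0034: "Since the ring `ℤ[ζ_ℓ]` is Dedekind, `Λ` is a direct sum `⊕_{j=1}^r P_j` of `r` invertible
  […] `ℤ[δ]`-modules […]. The `ℤ`-rank arguments imply that `2 dim(A) = r(ℓ - 1)`. […]
  `A^δ = (1-δ)⁻¹Λ/Λ ≅ Λ/(1-δ)Λ ≅ ℤ[ζ_ℓ]^r/(1-ζ_ℓ)ℤ[ζ_ℓ]^r = 𝔽_ℓ^r`."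

## Statement formalised, and the deviation

`A = X = E/Φ(ℤ^ι)` of positive dimension, `ℓ` prime, `D ∈ End(X) = endRingInt Φ` with `Φ_ℓ(D) = 0`,
`End_δ(X) = centralizerEnd Φ D` (a subring of `M_ι(ℤ) = End_ℤ(Λ)`, so a free `ℤ`-module of finite rank),
`A^δ = fixedSubgroup Φ D` with an `𝔽_ℓ`-structure `[Module (ZMod ℓ) (fixedSubgroup Φ D)]` (an `𝔽_ℓ`-space
of dimension `r = rk Λ/(ℓ - 1)`), `R = fixedImage Φ D ℓ ⊆ End_{𝔽_ℓ}(A^δ)` (FILE 2). The rank `d` over the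
Dedekind ring `ℤ[δ] ≅ ℤ[ζ_ℓ]` is rendered WITHOUT the structure theorem `M ≅ ⊕ P_j` ("`ℤ`-rank arguments",
as the notes say for `Λ`): for ANY additive subgroup `N ⊆ M_ι(ℤ)` stable under `U ↦ DU`, left
multiplication by `D` is an endomorphism of the free `ℤ`-module `N` annihilated by `Φ_ℓ`, so (gen 7's
`totient_dvd_card`, `det_one_sub_eq_pow` applied to its matrix in a `ℤ`-basis of `N`) `ℓ - 1 ∣ rk_ℤ N`
and `#(N/(1 - D)N) = |det(1 - D)|_N| = Φ_ℓ(1)^{rk N/(ℓ-1)} = ℓ^{rk N/(ℓ-1)}` (Mathlib's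
`Submodule.natAbs_det_equiv`) — the count the notes perform for `N = Λ` ("`Λ/(1-δ)Λ ≅ 𝔽_ℓ^r`"), here for
`N = End_δ(A)` with `d := rk_ℤ End_δ(A)/(ℓ - 1)`.

Results: `sub_one_dvd_finrank_centralizerEnd` (`ℓ - 1 ∣ rk_ℤ End_δ(X)`); `natCard_fixedImage`
(`#R = #(End_δ(X)/(1-δ)End_δ(X)) = ℓ^d`, via (2.19)); `finrank_fixedImage` (`dim_{𝔽_ℓ} R = d`);
`finrank_centralizerEnd_le` (Remark 2.17: `d ≤ r²`, i.e. `rk_ℤ End_δ(X) ≤ r²(ℓ - 1) = (rk Λ)²/(ℓ - 1)`);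
`finrank_centralizerEnd_eq_or_of_isVerySimple` ("`d = 1` or `d = r²`"); and the unconditional
characterisations `coe_centralizerEnd_eq_adjoin_iff_finrank` (`End_δ(X) = ℤ[δ] ⟺ rk_ℤ End_δ(X) = ℓ - 1`)
and `centralizerEnd_eq_centralizer_of_finrank_eq` (`rk_ℤ End_δ(X) = r²(ℓ - 1) ⟹ End_δ(X) = End_{ℤ[δ]}(Λ)`),
through FILE 2's two cases (`R = 𝔽_ℓ·Id`, resp. `R = End(A^δ)`, being forced by the dimension); the
packaged rank form `dolgachevZarhin_2_18_finrank` of Theorem 2.18, and the case `r = 1`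
(`finrank_centralizerEnd_eq_of_card_eq`: `rk Λ = ℓ - 1 ⟹ End_δ(X) = ℤ[δ] = End_{ℤ[δ]}(Λ)`, no Galois
hypothesis). Auxiliary: `finrank_adjoin_eq_sub_one` (`rk_ℤ ℤ[δ] = ℓ - 1`, from gen 7's
`ker_aeval_eq_span_cyclotomic`), `finrank_fixedSubgroup` (`dim_{𝔽_ℓ} A^δ = r`).

## References

* [DolgachevZarhin2024] I. Dolgachev, Yu. G. Zarhin, *Endomorphisms of Complex Abelian Varieties* (2024),
  §2.2 (2.17), Remark 2.17, Theorem 2.18 (proof), Lemma 2.19 (held text p0034–p0037).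
* [Zarhin2002CyclicCovers] Yu. G. Zarhin, *Cyclic covers of the projective line, their jacobians and
  endomorphisms*, J. reine angew. Math. 544 (2002), proof of Thm. 5.2 ("`T_p(J)` … a free
  `ℤ_p[δ_p]`-module of rank `2g/(p-1)`", "`R = Λ/ηΛ`", p0012).
-/

noncomputable section

open Module Matrix Function Polynomial
open Literature.RepresentationTheory

namespace Literature.Geometry.Kaehler

namespace ComplexTorus

variable {ι : Type*} [Fintype ι] [DecidableEq ι]

/-! ### §1 An additive subgroup `N ⊆ M_ι(ℤ)` stable under `U ↦ DU`, `Φ_n(D) = 0`: `φ(n) ∣ rk N` and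
`#(N/(1-D)N) = Φ_n(1)^{rk N/φ(n)}` -/

section Lattice

variable {D : Matrix ι ι ℤ} {n : ℕ} (N : Submodule ℤ (Matrix ι ι ℤ))

/-- Powers of the restricted left multiplication act by powers of `D`. [folklore] -/
private theorem coe_restrict_pow_apply (hN : ∀ U ∈ N, D * U ∈ N) (k : ℕ) (x : N) :
    (((((LinearMap.mulLeft ℤ D).restrict hN) ^ k) x : N) : Matrix ι ι ℤ) = D ^ k * (x : Matrix ι ι ℤ) := by
  induction k with
  | zero => rw [pow_zero, pow_zero, Matrix.one_mul, Module.End.one_apply]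
  | succ k ih =>
    rw [pow_succ', Module.End.mul_apply, pow_succ', Matrix.mul_assoc, ← ih]
    rfl

/-- Polynomials in the restricted left multiplication act by polynomials in `D`. [folklore] -/
private theorem coe_aeval_restrict_apply (hN : ∀ U ∈ N, D * U ∈ N) (P : ℤ[X]) (x : N) :
    (((aeval ((LinearMap.mulLeft ℤ D).restrict hN) P) x : N) : Matrix ι ι ℤ) =
      aeval D P * (x : Matrix ι ι ℤ) := by
  induction P using Polynomial.induction_on' with
  | add p q hp hq =>
    rw [map_add, LinearMap.add_apply, Submodule.coe_add, hp, hq, map_add, Matrix.add_mul]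
  | monomial k a =>
    rw [aeval_monomial, aeval_monomial, Module.End.mul_apply, Algebra.algebraMap_eq_smul_one,
      Algebra.algebraMap_eq_smul_one, LinearMap.smul_apply, Module.End.one_apply, Submodule.coe_smul,
      coe_restrict_pow_apply N hN, Matrix.smul_mul, Matrix.one_mul, Matrix.smul_mul]

/-- **"The `ℤ`-rank arguments": `φ(n) ∣ rk_ℤ N`** for a non-zero additive subgroup `N ⊆ M_ι(ℤ)` stable
under left multiplication by `D`, `Φ_n(D) = 0` (the matrix of `U ↦ DU` in a `ℤ`-basis of `N` is
annihilated by `Φ_n`, so its characteristic polynomial is a power of `Φ_n`).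
[cite: DolgachevZarhin2024, §2.2 ("The `ℤ`-rank arguments imply that `2 dim(A) = r(ℓ − 1)`" and "`End_δ(A)` … is a projective `ℤ[δ]`-module of finite rank, say `d`", chunks p0034, p0036)] -/
theorem totient_dvd_finrank_of_mul_mem (hN : ∀ U ∈ N, D * U ∈ N) (hn : 0 < n)
    (hD : aeval D (cyclotomic n ℤ) = 0) (hN0 : N ≠ ⊥) :
    n.totient ∣ Module.finrank ℤ N := by
  set L : N →ₗ[ℤ] N := (LinearMap.mulLeft ℤ D).restrict hN with hL
  have hL0 : aeval L (cyclotomic n ℤ) = 0 := by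
    refine LinearMap.ext fun x ↦ Subtype.ext ?_
    rw [coe_aeval_restrict_apply N hN, hD, Matrix.zero_mul, LinearMap.zero_apply, Submodule.coe_zero]
  let b := Module.finBasis ℤ N
  have hpos : 0 < Module.finrank ℤ N := Module.finrank_pos_iff.2 (Submodule.nontrivial_iff_ne_bot.2 hN0)
  haveI : Nonempty (Fin (Module.finrank ℤ N)) := ⟨⟨0, hpos⟩⟩
  have hD' : aeval (LinearMap.toMatrix b b L) (cyclotomic n ℤ) = 0 := by
    change aeval (LinearMap.toMatrixAlgEquiv b L) (cyclotomic n ℤ) = 0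
    rw [aeval_algHom_apply, hL0, map_zero]
  have h := totient_dvd_card hn hD'
  rwa [Fintype.card_fin] at h

/-- `1 - D` is injective on `N` when `Φ_n(1) ≠ 0` (`V(1 - D) = Φ_n(1)`, `N` torsion-free). [folklore] -/
private theorem restrict_one_sub_injective (hN : ∀ U ∈ N, D * U ∈ N) (h1 : (cyclotomic n ℤ).eval 1 ≠ 0)
    (hD : aeval D (cyclotomic n ℤ) = 0) :
    Function.Injective ⇑((1 : N →ₗ[ℤ] N) - (LinearMap.mulLeft ℤ D).restrict hN) := by
  obtain ⟨V, -, -, -, hV⟩ := exists_one_sub_mul_eq_smul hD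
  rw [← LinearMap.ker_eq_bot, LinearMap.ker_eq_bot']
  intro x hx
  have hx' : (1 - D) * (x : Matrix ι ι ℤ) = 0 := by
    have h0 := congrArg (fun y : N ↦ (y : Matrix ι ι ℤ)) hx
    simp only [LinearMap.sub_apply, Module.End.one_apply, Submodule.coe_sub, Submodule.coe_zero] at h0
    rw [Matrix.sub_mul, Matrix.one_mul]
    exact h0
  have h2 : ((cyclotomic n ℤ).eval 1) • (x : Matrix ι ι ℤ) = 0 := by
    rw [← Matrix.one_mul (x : Matrix ι ι ℤ), ← Matrix.smul_mul, ← hV, Matrix.mul_assoc, hx', Matrix.mul_zero]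
  exact Subtype.ext ((smul_eq_zero.1 h2).resolve_left h1)

/-- **`#(N/(1 - D)N) = |Φ_n(1)|^{rk N/φ(n)}`** ("`Λ/(1-δ)Λ ≅ ℤ[ζ_ℓ]^r/(1-ζ_ℓ)ℤ[ζ_ℓ]^r = 𝔽_ℓ^r`",
"`End_δ(A)/(1-δ)End_δ(A)` is a `d`-dimensional `𝔽_ℓ`-algebra"), for a non-zero additive subgroup
`N ⊆ M_ι(ℤ)` stable under left multiplication by `D`, `Φ_n(D) = 0`, `Φ_n(1) ≠ 0`: the index of `(1 - D)N`
in `N` is `|det((1 - D)|_N)| = |Φ_n(1)|^{rk N/φ(n)}` (Mathlib's `Submodule.natAbs_det_equiv` and gen 7's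
`det_one_sub_eq_pow`). [cite: DolgachevZarhin2024, §2.2 (chunks p0034, p0036)] [cite: Zarhin2002CyclicCovers, proof of Thm 5.2 ("`R := Λ/ηΛ`", p0012)] -/
theorem natCard_quotient_one_sub_mul (hN : ∀ U ∈ N, D * U ∈ N) (hn : 0 < n)
    (hD : aeval D (cyclotomic n ℤ) = 0) (h1 : (cyclotomic n ℤ).eval 1 ≠ 0) (hN0 : N ≠ ⊥) :
    Nat.card (N ⧸ (N.map (LinearMap.mulLeft ℤ (1 - D))).comap N.subtype) =
      ((cyclotomic n ℤ).eval 1).natAbs ^ (Module.finrank ℤ N / n.totient) := by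
  set L : N →ₗ[ℤ] N := (LinearMap.mulLeft ℤ D).restrict hN with hL
  -- `(1 - D)N` as a submodule of `N` is the range of `1 - L`
  have hrange : (N.map (LinearMap.mulLeft ℤ (1 - D))).comap N.subtype = LinearMap.range (1 - L) := by
    ext x
    simp only [Submodule.mem_comap, Submodule.mem_map, Submodule.subtype_apply, LinearMap.mulLeft_apply,
      LinearMap.mem_range]
    constructor
    · rintro ⟨W, hW, hWx⟩
      refine ⟨⟨W, hW⟩, Subtype.ext ?_⟩
      rw [← hWx, LinearMap.sub_apply, Module.End.one_apply, Submodule.coe_sub, Matrix.sub_mul, Matrix.one_mul]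
      rfl
    · rintro ⟨y, rfl⟩
      refine ⟨y, y.2, ?_⟩
      rw [LinearMap.sub_apply, Module.End.one_apply, Submodule.coe_sub, Matrix.sub_mul, Matrix.one_mul]
      rfl
  rw [hrange]
  -- `N ≃ range (1 - L)` by `1 - L`, and the index is `|det(1 - L)|`
  have hinj := restrict_one_sub_injective N hN h1 hD
  let e : N ≃ₗ[ℤ] LinearMap.range (1 - L) := LinearEquiv.ofInjective (1 - L) hinj
  have hdet := Submodule.natAbs_det_equiv (LinearMap.range (1 - L)) e
  have he : (LinearMap.range (1 - L)).subtype ∘ₗ (e : N →+ LinearMap.range (1 - L)).toIntLinearMap = 1 - L :=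
    LinearMap.ext fun x ↦ rfl
  rw [he] at hdet
  rw [← hdet]
  -- `det(1 - L) = det(1 - D') = Φ_n(1)^{rk N/φ(n)}` in a `ℤ`-basis
  let b := Module.finBasis ℤ N
  have hpos : 0 < Module.finrank ℤ N := Module.finrank_pos_iff.2 (Submodule.nontrivial_iff_ne_bot.2 hN0)
  haveI : Nonempty (Fin (Module.finrank ℤ N)) := ⟨⟨0, hpos⟩⟩
  have hL0 : aeval L (cyclotomic n ℤ) = 0 := by
    refine LinearMap.ext fun x ↦ Subtype.ext ?_
    rw [coe_aeval_restrict_apply N hN, hD, Matrix.zero_mul, LinearMap.zero_apply, Submodule.coe_zero]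
  have hD' : aeval (LinearMap.toMatrix b b L) (cyclotomic n ℤ) = 0 := by
    change aeval (LinearMap.toMatrixAlgEquiv b L) (cyclotomic n ℤ) = 0
    rw [aeval_algHom_apply, hL0, map_zero]
  have hdet' : LinearMap.det (1 - L) = (1 - LinearMap.toMatrix b b L).det := by
    rw [← LinearMap.det_toMatrix b, map_sub, LinearMap.toMatrix_one]
  rw [hdet', det_one_sub_eq_pow hn hD', Int.natAbs_pow, Fintype.card_fin]

end Lattice

/-! ### §2 `End_δ(A)`: `ℓ - 1 ∣ rk_ℤ End_δ(A) = d(ℓ - 1)`, `#R = ℓ^d`, `dim_{𝔽_ℓ} R = d` -/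

section Rank

variable {E : Type*} [NormedAddCommGroup E] [NormedSpace ℂ E] (Φ : (ι → ℝ) ≃L[ℝ] E) {D : Matrix ι ι ℤ}
  {ℓ : ℕ}

/-- `End_δ(A) ≃ End_δ(A)` (subring vs. `ℤ`-submodule packaging), `ℤ`-linearly and identically on
carriers. [folklore] -/
private theorem exists_linearEquiv_centralizerEnd :
    ∃ e : centralizerEnd Φ D ≃ₗ[ℤ] AddSubgroup.toIntSubmodule (centralizerEnd Φ D).toAddSubgroup,
      ∀ x, ((e.symm x : centralizerEnd Φ D) : Matrix ι ι ℤ) = x :=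
  ⟨{ toFun := fun x ↦ ⟨x.1, x.2⟩
     invFun := fun x ↦ ⟨x.1, x.2⟩
     map_add' := fun _ _ ↦ rfl
     map_smul' := fun c x ↦ Subtype.ext (by
       change ((c • x : centralizerEnd Φ D) : Matrix ι ι ℤ) = c • (x : Matrix ι ι ℤ)
       exact map_zsmul (centralizerEnd Φ D).subtype c x)
     left_inv := fun _ ↦ rfl
     right_inv := fun _ ↦ rfl }, fun _ ↦ rfl⟩

/-- **"`End_δ(A)` is a projective `ℤ[δ]`-module of finite rank, say `d`" — `ℓ - 1 ∣ rk_ℤ End_δ(X)`**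
(`rk_ℤ End_δ(X) = d(ℓ - 1)`), for `δ ∈ End(X)`, `Φ_ℓ(δ) = 0`, `ℓ` prime.
[cite: DolgachevZarhin2024, §2.2 proof of Thm 2.18 (chunk p0036) and p0035 ("a direct sum of `d` projective `ℤ[δ]`-modules of rank `1`")] -/
theorem sub_one_dvd_finrank_centralizerEnd [Nonempty ι] (hℓ : ℓ.Prime) (hD : aeval D (cyclotomic ℓ ℤ) = 0)
    (hDe : D ∈ endRingInt Φ) : ℓ - 1 ∣ Module.finrank ℤ (centralizerEnd Φ D) := by
  obtain ⟨e, -⟩ := exists_linearEquiv_centralizerEnd Φ (D := D)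
  rw [e.finrank_eq, ← Nat.totient_prime hℓ]
  refine totient_dvd_finrank_of_mul_mem _ (fun U hU ↦ ?_) hℓ.pos hD ?_
  · exact (centralizerEnd Φ D).mul_mem (mem_centralizerEnd_iff.2 ⟨hDe, rfl⟩) hU
  · rw [Submodule.ne_bot_iff]
    exact ⟨1, (centralizerEnd Φ D).one_mem, one_ne_zero⟩

/-- **`rk_ℤ ℤ[δ] = ℓ - 1`**: `ℤ[δ] ≅ ℤ[t]/(Φ_ℓ(t))` (gen 7's (2.15)–(2.16)) is free of rank `deg Φ_ℓ = ℓ - 1`.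
[cite: DolgachevZarhin2024, §2.2 (2.16) ("`ℤ[ζ_ℓ]` is a free `ℤ`-module of rank `ℓ − 1`", chunk p0034)] -/
theorem finrank_adjoin_eq_sub_one [Nonempty ι] (hℓ : ℓ.Prime) (hD : aeval D (cyclotomic ℓ ℤ) = 0) :
    Module.finrank ℤ (Algebra.adjoin ℤ ({D} : Set (Matrix ι ι ℤ))) = ℓ - 1 := by
  let e : (ℤ[X] ⧸ Ideal.span {cyclotomic ℓ ℤ}) ≃ₐ[ℤ] Algebra.adjoin ℤ ({D} : Set (Matrix ι ι ℤ)) :=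
    ((Ideal.quotientEquivAlgOfEq ℤ (ker_aeval_eq_span_cyclotomic hℓ.pos hD).symm).trans
      (Ideal.quotientKerEquivRange (aeval D : ℤ[X] →ₐ[ℤ] Matrix ι ι ℤ))).trans
      (Subalgebra.equivOfEq _ _ (Algebra.adjoin_singleton_eq_range_aeval ℤ D).symm)
  rw [← e.toLinearEquiv.finrank_eq, finrank_quotient_span_eq_natDegree' (cyclotomic.monic ℓ ℤ),
    natDegree_cyclotomic, Nat.totient_prime hℓ]

/-- `A^δ` is finite (of order `ℓ^r`). [cite: DolgachevZarhin2024, §2.2 ("`A^δ` … finite-dimensional `𝔽_ℓ`-vector space", chunk p0033)] -/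
private theorem finite_fixedSubgroup [Nonempty ι] (hℓ : ℓ.Prime) (hD : aeval D (cyclotomic ℓ ℤ) = 0) :
    Finite (fixedSubgroup Φ D) :=
  Nat.finite_of_card_ne_zero (by rw [natCard_fixedSubgroup_of_prime Φ hℓ hD]; exact pow_ne_zero _ hℓ.ne_zero)

variable [Module (ZMod ℓ) (fixedSubgroup Φ D)]

/-- **"`End_δ(A)/(1-δ)End_δ(A)` is a `d`-dimensional `𝔽_ℓ`-algebra" and "`dim_{𝔽_ℓ}(R) = d`", counted:
`#R = #(End_δ(X)/(1 - δ)End_δ(X)) = ℓ^d`**, `d = rk_ℤ End_δ(X)/(ℓ - 1)` — `R ≅ End_δ(X)/(1-δ)End_δ(X)` by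
(2.19) and Lemma 2.19 (ii) (gen 7's `forall_fixed_eq_zero_iff`), and §1.
[cite: DolgachevZarhin2024, §2.2 proof of Thm 2.18 ("`dim_{𝔽_ℓ}(R) = dim_{𝔽_ℓ}(End_δ(A)/(1-δ)End_δ(A)) = d`", chunk p0036)] -/
theorem natCard_fixedImage [Nonempty ι] (hℓ : ℓ.Prime) (hD : aeval D (cyclotomic ℓ ℤ) = 0)
    (hDe : D ∈ endRingInt Φ) :
    Nat.card (fixedImage Φ D ℓ) = ℓ ^ (Module.finrank ℤ (centralizerEnd Φ D) / (ℓ - 1)) := by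
  haveI := Fact.mk hℓ
  set N : Submodule ℤ (Matrix ι ι ℤ) := AddSubgroup.toIntSubmodule (centralizerEnd Φ D).toAddSubgroup with hNdef
  have hN : ∀ U ∈ N, D * U ∈ N := fun U hU ↦
    (centralizerEnd Φ D).mul_mem (mem_centralizerEnd_iff.2 ⟨hDe, rfl⟩) hU
  have hN0 : N ≠ ⊥ := by
    rw [Submodule.ne_bot_iff]
    exact ⟨1, (centralizerEnd Φ D).one_mem, one_ne_zero⟩
  obtain ⟨e, he⟩ := exists_linearEquiv_centralizerEnd Φ (D := D)
  -- the action of `End_δ(A)` on `A^δ` as a `ℤ`-linear map on `N`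
  let f : centralizerEnd Φ D →+* Module.End (ZMod ℓ) (fixedSubgroup Φ D) :=
    (centralizerAction Φ D ℓ).comp (Subring.inclusion (centralizerEnd_le_centralizer Φ D))
  let g : N →ₗ[ℤ] Module.End (ZMod ℓ) (fixedSubgroup Φ D) :=
    f.toAddMonoidHom.toIntLinearMap ∘ₗ e.symm.toLinearMap
  have hg : ∀ x : N, g x = centralizerAction Φ D ℓ ⟨(x : Matrix ι ι ℤ), centralizerEnd_le_centralizer Φ D x.2⟩ := by
    intro x
    change centralizerAction Φ D ℓ (Subring.inclusion (centralizerEnd_le_centralizer Φ D) (e.symm x)) = _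
    congr 1
    exact Subtype.ext (he x)
  -- its range is `R`
  have hR : Nat.card (fixedImage Φ D ℓ) = Nat.card (LinearMap.range g) := by
    refine Nat.card_congr (Equiv.subtypeEquivRight fun x ↦ ?_)
    change x ∈ fixedImage Φ D ℓ ↔ x ∈ LinearMap.range g
    rw [mem_fixedImage_iff, LinearMap.mem_range]
    constructor
    · rintro ⟨U, hU, hx⟩
      exact ⟨⟨U, hU⟩, by rw [hg]; exact hx⟩
    · rintro ⟨y, hy⟩
      exact ⟨y, y.2, by rw [← hg]; exact hy⟩
  -- its kernel is `(1 - δ)End_δ(A)` (Lemma 2.19 (ii))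
  have hker : LinearMap.ker g = (N.map (LinearMap.mulLeft ℤ (1 - D))).comap N.subtype := by
    ext x
    rw [LinearMap.mem_ker, hg, centralizerAction_eq_zero_iff_forall]
    change (∀ t ∈ fixedSubgroup Φ D, mapMatrix Φ Φ (x : Matrix ι ι ℤ) t = 0) ↔ _
    rw [forall_fixed_eq_zero_iff Φ hℓ hD hDe x.2]
    simp only [Submodule.mem_comap, Submodule.mem_map, Submodule.subtype_apply, LinearMap.mulLeft_apply]
    constructor
    · rintro ⟨W, hW, hxW⟩
      exact ⟨W, hW, hxW.symm⟩
    · rintro ⟨W, hW, hWx⟩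
      exact ⟨W, hW, hWx.symm⟩
  rw [hR, ← Nat.card_congr (LinearMap.quotKerEquivRange g).toEquiv, hker,
    natCard_quotient_one_sub_mul N hN hℓ.pos hD (by rw [eval_one_cyclotomic_prime]; exact_mod_cast hℓ.ne_zero) hN0,
    eval_one_cyclotomic_prime, Int.natAbs_natCast, Nat.totient_prime hℓ, e.finrank_eq]

/-- **`dim_{𝔽_ℓ} A^δ = r = rk Λ/(ℓ - 1)`** for any `𝔽_ℓ`-structure on `A^δ`.
[cite: DolgachevZarhin2024, §2.2 ("`dim_{𝔽_ℓ}(A^δ) = r = 2dim(A)/(ℓ − 1)`", chunk p0034)] -/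
theorem finrank_fixedSubgroup [Nonempty ι] (hℓ : ℓ.Prime) (hD : aeval D (cyclotomic ℓ ℤ) = 0) :
    Module.finrank (ZMod ℓ) (fixedSubgroup Φ D) = Fintype.card ι / (ℓ - 1) := by
  haveI := Fact.mk hℓ
  haveI := finite_fixedSubgroup Φ hℓ hD
  haveI : Module.Finite (ZMod ℓ) (fixedSubgroup Φ D) := Module.Finite.of_finite
  have h : Nat.card (fixedSubgroup Φ D) = Nat.card (ZMod ℓ) ^ Module.finrank (ZMod ℓ) (fixedSubgroup Φ D) :=
    Module.natCard_eq_pow_finrank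
  rw [natCard_fixedSubgroup_of_prime Φ hℓ hD, Nat.card_zmod] at h
  exact (Nat.pow_right_injective hℓ.two_le h).symm

/-- **"`dim_{𝔽_ℓ}(R) = d`"**: the image `R` of (2.19) has `𝔽_ℓ`-dimension `d = rk_ℤ End_δ(X)/(ℓ - 1)`.
[cite: DolgachevZarhin2024, §2.2 proof of Thm 2.18 ("`dim_{𝔽_ℓ}(R) = … = d`", chunk p0036)] -/
theorem finrank_fixedImage [Nonempty ι] (hℓ : ℓ.Prime) (hD : aeval D (cyclotomic ℓ ℤ) = 0)
    (hDe : D ∈ endRingInt Φ) :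
    Module.finrank (ZMod ℓ) (fixedImage Φ D ℓ) = Module.finrank ℤ (centralizerEnd Φ D) / (ℓ - 1) := by
  haveI := Fact.mk hℓ
  haveI := finite_fixedSubgroup Φ hℓ hD
  haveI : Module.Finite (ZMod ℓ) (fixedSubgroup Φ D) := Module.Finite.of_finite
  haveI : Module.Finite (ZMod ℓ) (fixedImage Φ D ℓ) :=
    Module.Finite.of_injective (fixedImage Φ D ℓ).val.toLinearMap Subtype.val_injective
  have h : Nat.card (fixedImage Φ D ℓ) = Nat.card (ZMod ℓ) ^ Module.finrank (ZMod ℓ) (fixedImage Φ D ℓ) :=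
    Module.natCard_eq_pow_finrank
  rw [natCard_fixedImage Φ hℓ hD hDe, Nat.card_zmod] at h
  exact (Nat.pow_right_injective hℓ.two_le h).symm

/-- **Remark 2.17, "`d ≤ r²`"**: `dim_{𝔽_ℓ} R ≤ dim End_{𝔽_ℓ}(A^δ) = r²`, i.e.
`rk_ℤ End_δ(X) ≤ r²(ℓ - 1) = (rk Λ)²/(ℓ - 1)` with `r = rk Λ/(ℓ - 1)` — for every `δ ∈ End(X)` with
`Φ_ℓ(δ) = 0` (no very-simplicity hypothesis). [cite: DolgachevZarhin2024, §2.2 Remark 2.17 ("Comparing the ranks in (2.17), we obtain the inequality `d ≤ r²`", chunk p0035)] -/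
theorem finrank_centralizerEnd_le [Nonempty ι] (hℓ : ℓ.Prime) (hD : aeval D (cyclotomic ℓ ℤ) = 0)
    (hDe : D ∈ endRingInt Φ) :
    Module.finrank ℤ (centralizerEnd Φ D) / (ℓ - 1) ≤ (Fintype.card ι / (ℓ - 1)) ^ 2 ∧
      Module.finrank ℤ (centralizerEnd Φ D) ≤ (Fintype.card ι / (ℓ - 1)) ^ 2 * (ℓ - 1) := by
  haveI := Fact.mk hℓ
  haveI := finite_fixedSubgroup Φ hℓ hD
  haveI : Module.Finite (ZMod ℓ) (fixedSubgroup Φ D) := Module.Finite.of_finite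
  have h1 : Module.finrank ℤ (centralizerEnd Φ D) / (ℓ - 1) ≤ (Fintype.card ι / (ℓ - 1)) ^ 2 := by
    rw [← finrank_fixedImage Φ hℓ hD hDe, ← Subalgebra.finrank_toSubmodule, sq, ← finrank_fixedSubgroup Φ hℓ hD,
      ← Module.finrank_linearMap (R := ZMod ℓ) (S := ZMod ℓ)]
    exact Submodule.finrank_le _
  refine ⟨h1, ?_⟩
  have h2 := Nat.div_mul_cancel (sub_one_dvd_finrank_centralizerEnd Φ hℓ hD hDe)
  rw [← h2]
  exact Nat.mul_le_mul_right _ h1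

/-- **"Since the Galois module `A^δ` is very simple, either `d = 1` or `d = (dim_{𝔽_ℓ}(A^δ))² = r²`"**: under
the hypotheses of Theorem 2.18 (at torus level: `R` is `G`-normal and the `G`-module `A^δ` is very simple),
`rk_ℤ End_δ(X) = ℓ - 1` or `rk_ℤ End_δ(X) = r²(ℓ - 1)`.
[cite: DolgachevZarhin2024, §2.2 proof of Thm 2.18 (chunk p0036)] -/
theorem finrank_centralizerEnd_eq_or_of_isVerySimple [Nonempty ι] (hℓ : ℓ.Prime)
    (hD : aeval D (cyclotomic ℓ ℤ) = 0) (hDe : D ∈ endRingInt Φ) {G : Type*} [Group G]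
    {ρ : Representation (ZMod ℓ) G (fixedSubgroup Φ D)} (hnorm : IsNormalSubalgebra ρ (fixedImage Φ D ℓ))
    (hvs : IsVerySimple ρ) :
    Module.finrank ℤ (centralizerEnd Φ D) = ℓ - 1 ∨
      Module.finrank ℤ (centralizerEnd Φ D) = (Fintype.card ι / (ℓ - 1)) ^ 2 * (ℓ - 1) := by
  haveI := Fact.mk hℓ
  haveI := finite_fixedSubgroup Φ hℓ hD
  haveI : Module.Finite (ZMod ℓ) (fixedSubgroup Φ D) := Module.Finite.of_finite
  haveI : Nontrivial (fixedSubgroup Φ D) := hvs.1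
  have hd := finrank_fixedImage Φ hℓ hD hDe
  have h2 := Nat.div_mul_cancel (sub_one_dvd_finrank_centralizerEnd Φ hℓ hD hDe)
  rcases hvs.eq_bot_or_eq_top hnorm with hbot | htop
  · left
    rw [hbot, Subalgebra.finrank_bot] at hd
    rw [← h2, ← hd, one_mul]
  · right
    rw [htop, ← Subalgebra.finrank_toSubmodule, Algebra.top_toSubmodule, finrank_top,
      Module.finrank_linearMap (R := ZMod ℓ) (S := ZMod ℓ), finrank_fixedSubgroup Φ hℓ hD, ← sq] at hd
    rw [← h2, ← hd]

/-- **The first alternative by rank: `End_δ(X) = ℤ[δ] ⟺ rk_ℤ End_δ(X) = ℓ - 1`** (for every `δ ∈ End(X)`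
with `Φ_ℓ(δ) = 0`; "⟸": `d = 1` forces `R = 𝔽_ℓ·Id`, and then FILE 2's first case applies — "If `d = 1`
… we conclude that `ℤ[δ] = End_δ(A)`"). [cite: DolgachevZarhin2024, §2.2 proof of Thm 2.18, case `d = 1` (chunk p0036)] -/
theorem coe_centralizerEnd_eq_adjoin_iff_finrank [Nonempty ι] (hℓ : ℓ.Prime)
    (hD : aeval D (cyclotomic ℓ ℤ) = 0) (hDe : D ∈ endRingInt Φ) :
    (centralizerEnd Φ D : Set (Matrix ι ι ℤ)) = Algebra.adjoin ℤ ({D} : Set (Matrix ι ι ℤ)) ↔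
      Module.finrank ℤ (centralizerEnd Φ D) = ℓ - 1 := by
  haveI := Fact.mk hℓ
  constructor
  · intro h
    -- transport the rank along the equality of carriers
    let e : centralizerEnd Φ D ≃ₗ[ℤ] Algebra.adjoin ℤ ({D} : Set (Matrix ι ι ℤ)) :=
      { toFun := fun x ↦ ⟨x.1, by rw [← SetLike.mem_coe, ← h]; exact x.2⟩
        invFun := fun x ↦ ⟨x.1, by rw [← SetLike.mem_coe, h]; exact x.2⟩
        map_add' := fun _ _ ↦ rfl
        map_smul' := fun c x ↦ Subtype.ext (by
          change ((c • x : centralizerEnd Φ D) : Matrix ι ι ℤ) = c • (x : Matrix ι ι ℤ)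
          exact map_zsmul (centralizerEnd Φ D).subtype c x)
        left_inv := fun _ ↦ rfl
        right_inv := fun _ ↦ rfl }
    rw [e.finrank_eq, finrank_adjoin_eq_sub_one hℓ hD]
  · intro h
    haveI := finite_fixedSubgroup Φ hℓ hD
    haveI : Module.Finite (ZMod ℓ) (fixedSubgroup Φ D) := Module.Finite.of_finite
    have hd := finrank_fixedImage Φ hℓ hD hDe
    rw [h, Nat.div_self (Nat.sub_pos_of_lt hℓ.one_lt)] at hd
    exact coe_centralizerEnd_eq_adjoin_of_fixedImage_eq_bot Φ hℓ hD hDe (Subalgebra.eq_bot_of_finrank_one hd)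

/-- **The second alternative by rank: `rk_ℤ End_δ(X) = r²(ℓ - 1) ⟹ End_δ(X) = End_{ℤ[δ]}(Λ)`** (for
every `δ ∈ End(X)` with `Φ_ℓ(δ) = 0`: `d = r²` forces `R = End_{𝔽_ℓ}(A^δ)`, and FILE 2's second case — "Let
us assume that `d = r²`. By Remark 2.17, `End_δ(A) = End_{ℤ[δ]}(Λ)`" — applies).
[cite: DolgachevZarhin2024, §2.2 proof of Thm 2.18, case `d = r²`, and Remark 2.17 / (2.18) (chunks p0035–p0037)] -/
theorem centralizerEnd_eq_centralizer_of_finrank_eq [Nonempty ι] (hℓ : ℓ.Prime)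
    (hD : aeval D (cyclotomic ℓ ℤ) = 0) (hDe : D ∈ endRingInt Φ)
    (h : Module.finrank ℤ (centralizerEnd Φ D) = (Fintype.card ι / (ℓ - 1)) ^ 2 * (ℓ - 1)) :
    centralizerEnd Φ D = Subring.centralizer ({D} : Set (Matrix ι ι ℤ)) := by
  haveI := Fact.mk hℓ
  haveI := finite_fixedSubgroup Φ hℓ hD
  haveI : Module.Finite (ZMod ℓ) (fixedSubgroup Φ D) := Module.Finite.of_finite
  have hd := finrank_fixedImage Φ hℓ hD hDe
  rw [h, Nat.mul_div_cancel _ (Nat.sub_pos_of_lt hℓ.one_lt), sq, ← finrank_fixedSubgroup Φ hℓ hD,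
    ← Module.finrank_linearMap (R := ZMod ℓ) (S := ZMod ℓ), ← Subalgebra.finrank_toSubmodule] at hd
  have htop : fixedImage Φ D ℓ = ⊤ :=
    Algebra.toSubmodule_eq_top.1 (Submodule.eq_top_of_finrank_eq hd)
  exact centralizerEnd_eq_centralizer_of_fixedImage_eq_top Φ hℓ hD hDe htop

/-- **Theorem 2.18 at torus level, rank form**: under its hypotheses (`R` normal for `G`, the `G`-module
`A^δ` very simple), EITHER `rk_ℤ End_δ(X) = ℓ - 1` and `End_δ(X) = ℤ[δ]`, OR
`rk_ℤ End_δ(X) = r²(ℓ - 1)` and `End_δ(X) = End_{ℤ[δ]}(Λ)` (the consequences of the second case —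
`C(δ) ⊆ End⁰(X)`, `C(δ) ≅ M_r(ℚ(ζ_ℓ))`, `X ∼ B^r` with `ℚ(ζ_ℓ) ↪ End⁰(B)` — are FILE 2's
`dolgachevZarhin_2_18` and FILE 3). [cite: DolgachevZarhin2024, §2.2 Thm 2.18 and its proof (chunks p0035–p0037)] -/
theorem dolgachevZarhin_2_18_finrank [Nonempty ι] (hℓ : ℓ.Prime)
    (hD : aeval D (cyclotomic ℓ ℤ) = 0) (hDe : D ∈ endRingInt Φ) {G : Type*} [Group G]
    {ρ : Representation (ZMod ℓ) G (fixedSubgroup Φ D)} (hnorm : IsNormalSubalgebra ρ (fixedImage Φ D ℓ))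
    (hvs : IsVerySimple ρ) :
    (Module.finrank ℤ (centralizerEnd Φ D) = ℓ - 1 ∧
        (centralizerEnd Φ D : Set (Matrix ι ι ℤ)) = Algebra.adjoin ℤ ({D} : Set (Matrix ι ι ℤ))) ∨
      (Module.finrank ℤ (centralizerEnd Φ D) = (Fintype.card ι / (ℓ - 1)) ^ 2 * (ℓ - 1) ∧
        centralizerEnd Φ D = Subring.centralizer ({D} : Set (Matrix ι ι ℤ))) := by
  rcases finrank_centralizerEnd_eq_or_of_isVerySimple Φ hℓ hD hDe hnorm hvs with h | h
  · exact Or.inl ⟨h, (coe_centralizerEnd_eq_adjoin_iff_finrank Φ hℓ hD hDe).2 h⟩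
  · exact Or.inr ⟨h, centralizerEnd_eq_centralizer_of_finrank_eq Φ hℓ hD hDe h⟩

/-- **Remark 2.17 with `r = 1`**: if `rk Λ = ℓ - 1` then `d ≤ r² = 1` forces `d = 1`, so
`rk_ℤ End_δ(X) = ℓ - 1` and `End_δ(X) = ℤ[δ] = End_{ℤ[δ]}(Λ)` for every `δ ∈ End(X)` with `Φ_ℓ(δ) = 0`
(no hypothesis on a Galois action; both alternatives of Theorem 2.18 hold at once).
[cite: DolgachevZarhin2024, §2.2 Remark 2.17 (`d ≤ r²`) and proof of Thm 2.18, case `d = 1` (chunks p0035–p0036)] -/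
theorem finrank_centralizerEnd_eq_of_card_eq [Nonempty ι] (hℓ : ℓ.Prime)
    (hD : aeval D (cyclotomic ℓ ℤ) = 0) (hDe : D ∈ endRingInt Φ) (hr : Fintype.card ι = ℓ - 1) :
    Module.finrank ℤ (centralizerEnd Φ D) = ℓ - 1 ∧
      (centralizerEnd Φ D : Set (Matrix ι ι ℤ)) = Algebra.adjoin ℤ ({D} : Set (Matrix ι ι ℤ)) ∧
      centralizerEnd Φ D = Subring.centralizer ({D} : Set (Matrix ι ι ℤ)) := by
  have hℓ1 : 0 < ℓ - 1 := Nat.sub_pos_of_lt hℓ.one_lt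
  have hle := (finrank_centralizerEnd_le Φ hℓ hD hDe).2
  rw [hr, Nat.div_self hℓ1, one_pow, one_mul] at hle
  obtain ⟨e, -⟩ := exists_linearEquiv_centralizerEnd Φ (D := D)
  have hpos : 0 < Module.finrank ℤ (centralizerEnd Φ D) := by
    rw [e.finrank_eq]
    refine Module.finrank_pos_iff.2 (Submodule.nontrivial_iff_ne_bot.2 ?_)
    rw [Submodule.ne_bot_iff]
    exact ⟨1, (centralizerEnd Φ D).one_mem, one_ne_zero⟩
  have h : Module.finrank ℤ (centralizerEnd Φ D) = ℓ - 1 :=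
    le_antisymm hle (Nat.le_of_dvd hpos (sub_one_dvd_finrank_centralizerEnd Φ hℓ hD hDe))
  refine ⟨h, (coe_centralizerEnd_eq_adjoin_iff_finrank Φ hℓ hD hDe).2 h,
    centralizerEnd_eq_centralizer_of_finrank_eq Φ hℓ hD hDe ?_⟩
  rw [h, hr, Nat.div_self hℓ1, one_pow, one_mul]

end Rank

end ComplexTorus

end Literature.Geometry.Kaehler

end
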